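import Mathlib.Data.Fintype.Card
import Mathlib.Data.Finset.Card
import Mathlib.Data.Fintype.Fin
import Mathlib.Algebra.BigOperators.Group.Finset.Basic
import Mathlib.Algebra.Group.Nat.Even
import Mathlib.Order.Lattice.Nat
import Mathlib.Logic.Relation
import HarnessLib

/-!
# Feldman–Salmhofer–Trubowitz III, §2: classification of skeleton graphs — doubly overlapping
# (DOL) graphs, Theorem 2.4 / Lemma 2.5, Theorem 2.6 (sunset, multiple sunset, wicked ladder)

J. Feldman, M. Salmhofer, E. Trubowitz, *Regularity of interacting nonspherical Fermi surfaces: the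
full self-energy*, Comm. Pure Appl. Math. **52** (1999) 273–324 = arXiv:cond-mat/9705272 ("FST III")
[FeldmanSalmhoferTrubowitz1999], Chapter 2 "Classification of Skeleton Graphs" — "graph theoretical and
… self-contained" (p0004:L1–5). §1 of the paper (hypotheses, Theorems 1.1/1.2) is
`FermiRG/FST3Main.lean`; this is the per-section module for §2 (gate-hubbard-kl typer wave, DAG rows
FST3.L1 = Lemma 2.5, FST3.T2 = Theorem 2.6, aid row FST3.T2.4 = Theorem 2.4; STATEMENTS-FIRST: real
definitions, the two printed results as NAMED FACTS `lemma25`, `theorem26` (licences F-035, F-036),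
Theorem 2.4 PROVED from `lemma25`, and elementary sanity theorems; nothing else is asserted).

LOCATORS. `p000N:Ln` = chunk `p000N.txt`, line `n`, of the TeX render `lit read arxiv:cond-mat/9705272`
(key `paper:arxiv-cond-mat_9705272`, 22 chunks; macro-words such as "overlapping", "multiple sunset",
"wicked ladder" and all theorem NUMBERS are dropped by that render); numbers and figures were read on the
PDF render (key `paper:arxiv-cond-mat-9705272`, 166 chunks: "**Definition 2.1**" p0012, "**Theorem 2.4**",
"**Lemma 2.5**" p0021, "**Theorem 2.6**" p0097, Figure 1 "The sunset graph", Figure 7 "The multiple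
sunset" (`m ≥ 5` lines), Figure 12 "The wicked ladder. There may be an arbitrary number of bubbles",
Figure 3 (the form of Lemma 2.5) — the figures are embedded images in that render and were viewed).

## The graphs (p0004:L17–39)

"We denote the vertex set of a graph `G` by `V(G)` and its set of internal lines by `L(G)`. A line is
internal (resp. external) if both (resp. only one) of its ends are hooked to vertices … If a vertex
`v ∈ V(G)` has incidence number `n`, we call it an `n`-legged vertex. A vertex is called external if it
is hooked to an external leg of the graph. … We assume throughout that all graphs have vertices with
even incidence number." Lines may have both ends at the same vertex ("If `v = w`, the loop generated by
`ℓ` contains only the line `ℓ`", p0004:L50; "self–contractions", Thm 2.6). CARRIER: `FGraph V L` = two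
endpoint maps `fst snd : L → V` on a type `L` of internal lines (an unordered line recorded with an
arbitrary orientation; every notion below is orientation-symmetric) and `ext : V → ℕ`, the number of
external legs hooked to each vertex; `V`, `L` finite types with decidable equality at use sites.
CROSS-REFERENCE (not restated, different carrier): the tree's Feynman-graph EDGE LISTS
`E : Fin N → Fin (V+1) × Fin (V+1)` of `MathematicalPhysics/QuantumFieldTheory/GraphPeriod.lean`
(`IsConnectedEdgeList`, rank of the incidence matrix) and `…/HeppBound.lean` (`IsSpanningTree E T :=
T.card = V ∧ edgeRank E T = V`) have no external legs and phrase connectivity through matrix rank; FST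
III §2 argues with walks, minimal paths and balls (`S_k`, `T_m`), so connectivity here is
`Relation.ReflTransGen` of adjacency and a spanning tree is "connects all vertices with `|V| - 1`
lines" (equivalent characterisations; no bridge lemma is claimed).

## Contents (namespace `Literature.MathematicalPhysics.QuantumLattice.FermiRG.FST3.FGraph`)

* incidence number, `EvenIncidence`, `IsTwoLegged` (`E = 2`), `Reachable`, `IsConnected`, subgraphs
  `(W, M)` with their number of legs `subgraphLegs`, `IsSkeleton` (p0004:L31–32, verbatim: connected,
  `≥ 2` vertices, no two-legged vertex, no proper two-legged subgraph), `IsOnePI` (p0004:L33–35);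
* spanning trees, "the loop generated by `ℓ` (and `T`) contains `θ`" (p0004:L43–53) in the path-free
  form `LoopContains` (the ends of `ℓ` are separated in `T - θ`), `IsOverlapping` (p0004:L54–58, the
  notion of FST I recalled there), Definition 2.1 `TwoSeparateOverlaps` / `IsDOL` (p0004:L73–80);
* `ballStep`/`ball` (`S_k`, `T_m` of the proof of Lemma 2.5, p0005:L57–77), `edist` (the integer `t`,
  p0005:L29–37), `linesBetween`, `IsConnectedOn`;
* the three families of Theorem 2.6 MODULO SELF-CONTRACTIONS ("with the vertices possibly being
  `2m`–legged vertices with `m-2` self–contractions"): `IsSunsetShape` (Figure 1: two vertices, three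
  lines), `IsMultipleSunsetShape` (Figure 7: two vertices, `m ≥ 5` lines), `IsWickedLadderShape a b n`
  (Figure 12: a path `a = u₀, u₁, …, uₙ = b` of `n ≥ 2` bubbles — consecutive vertices joined by exactly
  two lines — closed by ONE line `a—b`, no other lines between distinct vertices); `lineCount v w`
  counts the lines joining two DISTINCT vertices, so self-contractions are invisible to the shapes;
* NAMED FACTS `lemma25` (Lemma 2.5 with its Figure-3 clause; F-035) and `theorem26` (F-036); PROVED:
  `theorem24` (Theorem 2.4 from `lemma25`), `IsDOL.isOverlapping`, `IsDOL.three_le_card` ("the graph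
  has to have at least three vertices", p0004:L84–85), `not_isDOL_of_card_le_two`, hence the sunset and
  the multiple sunset are not DOL (`IsSunsetShape.not_isDOL`, `IsMultipleSunsetShape.not_isDOL`),
  `not_loopContains_of_isSelfContraction` (p0004:L50).

## Flags (typing decisions the referee should see)

1. THEOREM 2.6 AND `t = 0`. The print (p0006:L104–108) — "In summary, we have proven the following
   theorem. Let `G` be a non–DOL two–legged skeleton graph. Then `G` is a sunset, or a multiple sunset,
   or a wicked ladder, with the vertices possibly being `2m`–legged vertices with `m-2`
   self–contractions" — summarises §2.1 (`t ≥ 2`, Theorem 2.4) and §2.2 ("Graphs with `t = 1`. … We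
   call the external vertices `v₀` and `v₁`", p0006:L41–44), i.e. graphs whose two external legs sit at
   two DISTINCT vertices. Two-legged skeleton graphs with both external legs at ONE vertex (`t = 0`) are
   treated separately by the paper itself (Theorem 3.11: "`G̃` … is a sunset, or a wicked ladder, or has
   only one external vertex", p0016:L171–175; its proof: "The remaining case is `t_G̃ = 0` … Otherwise,
   `G` is overlapping", p0018:L54–56) and contain non-DOL members outside the three families (a vertex
   carrying both external legs joined by four lines to a four-legged vertex: two vertices, so no
   spanning tree has the two lines Definition 2.1 needs; more generally rings of bubbles through the
   external vertex). `theorem26` therefore carries the §2.2 set-up `a ≠ b` for the external vertices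
   EXPLICITLY; the literal universal reading over all two-legged skeleton graphs would be false.
   Exhaustive check of THESE definitions (seat script `check/fst3sec2_check.py`, results
   `check/results_local.txt`): all two-legged even-incidence multigraphs with `≤ 6` vertices and `≤ 12`
   lines and all with `7` four-legged vertices (37 048 skeleton graphs; self-contraction smoke tests for
   `≤ 5` vertices): every skeleton with `t ≥ 2` is DOL and satisfies the Figure-3 clause of `lemma25`
   (0 failures); every non-DOL skeleton with `t ≥ 1` is one of the three shapes modulo self-contractions
   (170 cases); no graph of the three shapes is DOL; and 98 non-DOL skeletons with `t = 0` lie outside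
   the three families (the flag above).
2. LEMMA 2.5'S FIGURES. "`G` takes the form shown in Figure 3" is typed through the sets the proof
   uses (p0005:L81–107): `G₁ = S_r` = the ball of radius `r` about `v₀`, `G₂ = T_{t-s-1}` = the ball of
   radius `t-s-1` about `v_t`, `G'` = the remaining vertices; conclusions: `G₁`, `G₂` disjoint and
   connected, no line joins `G₁` to `G₂`, and each is joined to `G'` by at least three lines (the proof
   shows these numbers are odd, "`k₁ ≥ 3` and `k₂ ≥ 3`", L103–107). The further alternative "If it is
   not possible to choose `G₁`, `G₂` and `G'` all connected, then `G` is as indicated in Figure 5 … or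
   as in Figure 6 …" (a description of the components of `G'`, p0005:L48–55) is NOT typed (docstring
   only); omitting a conclusion weakens, never strengthens, the fact.
3. "Subgraph": a pair `(W, M)` of a vertex set and a set of lines with both ends in `W`; its legs are
   the external legs of `G` at `W` plus the ends in `W` of the lines of `G` not in `M` (so `(V(G), L(G))`
   has `E(G)` legs and a single vertex `v` has `n(v)` legs); "proper" = `≠ (V(G), L(G))`. "The statement
   that `G` has a two–legged subgraph `H` includes the requirement that `H` is a proper subgraph of `G`"
   (p0006:L116–118).
4. Not typed here: Remark 2.2 (`H` and `G/H` overlapping ⇒ `G` DOL; needs quotient graphs), Remark 2.3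
   / Figure 2 (an example), §2.3 Lemma 2.7 (2PI characterisation; not a DAG row), and everything of §3
   (scale decompositions, graph VALUES — see the GAP register of the cell, class W-004).

Typer lint: no `instance`, no `notation`, no attribute changes; imports `Mathlib`/`HarnessLib` only.
-/

namespace Literature.MathematicalPhysics.QuantumLattice.FermiRG

namespace FST3

universe u v

/-- A (Feynman) graph in the sense of FST III §2 (p0004:L17–29): a finite set of vertices `V(G)`, a
finite set `L(G)` of internal lines, each with its two ends hooked to vertices (`fst l`, `snd l`; both
ends may sit at the same vertex — a self-contraction), and external legs, `ext v` of them hooked to the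
vertex `v`. The orientation `fst/snd` of a line is bookkeeping only.
[cite: FeldmanSalmhoferTrubowitz1999, §2 p0004:L17-29] -/
structure FGraph (V : Type u) (L : Type v) where
  /-- one end of the internal line `l` -/
  fst : L → V
  /-- the other end of the internal line `l` -/
  snd : L → V
  /-- the number of external legs hooked to the vertex `v` -/
  ext : V → ℕ

namespace FGraph

variable {V : Type u} {L : Type v}

section Incidence

variable (G : FGraph V L)

/-- The line `l` joins the vertices `v` and `w` (in either orientation; `v = w` for a
self-contraction). An `abbrev`, so that it is decidable by unfolding.
[cite: FeldmanSalmhoferTrubowitz1999, §2 p0004:L17-19] -/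
abbrev Joins (l : L) (v w : V) : Prop :=
  (G.fst l = v ∧ G.snd l = w) ∨ (G.fst l = w ∧ G.snd l = v)

/-- `l` is a self-contraction: both ends at the same vertex ("`2m`–legged vertices with `m-2`
self–contractions", Thm 2.6). [cite: FeldmanSalmhoferTrubowitz1999, Thm 2.6 p0006:L107-108] -/
def IsSelfContraction (l : L) : Prop := G.fst l = G.snd l

/-- The number of ends (`0`, `1` or `2`) of the line `l` hooked to the vertex `v`.
[cite: FeldmanSalmhoferTrubowitz1999, §2 p0004:L19-21] -/
def endsAt [DecidableEq V] (l : L) (v : V) : ℕ :=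
  (if G.fst l = v then 1 else 0) + (if G.snd l = v then 1 else 0)

/-- The incidence number of the vertex `v`: external legs plus ends of internal lines hooked to `v`
(a self-contraction at `v` contributes `2`); "an `n`-legged vertex".
[cite: FeldmanSalmhoferTrubowitz1999, §2 p0004:L20-21] -/
def incidence [Fintype L] [DecidableEq V] (v : V) : ℕ := G.ext v + ∑ l, G.endsAt l v

/-- The standing assumption "all graphs have vertices with even incidence number" (p0004:L26–27).
[cite: FeldmanSalmhoferTrubowitz1999, §2 p0004:L24-29] -/
def EvenIncidence [Fintype L] [DecidableEq V] : Prop := ∀ v, Even (G.incidence v)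

/-- `v` is an external vertex: "hooked to an external leg of the graph" (p0004:L22–23).
[cite: FeldmanSalmhoferTrubowitz1999, §2 p0004:L22-23] -/
def IsExternalVertex (v : V) : Prop := 0 < G.ext v

/-- `E(G)`, the number of external legs of `G` (p0006:L142–143).
[cite: FeldmanSalmhoferTrubowitz1999, §2 p0004:L24-25] -/
def numExt [Fintype V] : ℕ := ∑ v, G.ext v

/-- `G` is two-legged: `E(G) = 2`. [cite: FeldmanSalmhoferTrubowitz1999, §2 p0004:L86-88] -/
def IsTwoLegged [Fintype V] : Prop := G.numExt = 2

/-- The number of lines joining the DISTINCT vertices `v ≠ w` (for `v = w` it would count the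
self-contractions at `v`; it is only used with `v ≠ w`, so that self-contractions are invisible).
[cite: FeldmanSalmhoferTrubowitz1999, §2.2 p0006:L44-46] -/
def lineCount [Fintype L] [DecidableEq V] (v w : V) : ℕ :=
  (Finset.univ.filter fun l => G.Joins l v w).card

end Incidence

section Connectivity

variable (G : FGraph V L)

/-- Adjacency through the lines of `S ⊆ L(G)`: some line of `S` joins `v` and `w`.
[cite: FeldmanSalmhoferTrubowitz1999, §2 p0004:L44-53] -/
def Adj (S : Finset L) (v w : V) : Prop := ∃ l ∈ S, G.Joins l v w

/-- `w` can be reached from `v` by a walk over lines of `S` (reflexive–transitive closure of `Adj S`).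
[cite: FeldmanSalmhoferTrubowitz1999, §2 p0005:L57-58] -/
def Reachable (S : Finset L) : V → V → Prop := Relation.ReflTransGen (G.Adj S)

/-- `G` is connected (every two vertices are joined by a walk over internal lines).
[cite: FeldmanSalmhoferTrubowitz1999, §2 p0004:L31] -/
def IsConnected [Fintype L] : Prop := ∀ v w, G.Reachable Finset.univ v w

/-- The lines of `G` with both ends in the vertex set `W` ("The lines of `S_k` are all those lines
`l ∈ L(G)` that join vertices in `S_k`", p0005:L66–67). [cite: FeldmanSalmhoferTrubowitz1999, Lemma 2.5 (proof) p0005:L66-67] -/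
def induced [Fintype L] [DecidableEq V] (W : Finset V) : Finset L :=
  Finset.univ.filter fun l => G.fst l ∈ W ∧ G.snd l ∈ W

/-- The subgraph spanned by the vertex set `W` (with all lines of `G` joining vertices of `W`) is
connected. [cite: FeldmanSalmhoferTrubowitz1999, Lemma 2.5 p0005:L46] -/
def IsConnectedOn [Fintype L] [DecidableEq V] (W : Finset V) : Prop :=
  ∀ v ∈ W, ∀ w ∈ W, G.Reachable (G.induced W) v w

/-- The lines of `G` joining a vertex of `W₁` to a vertex of `W₂`.
[cite: FeldmanSalmhoferTrubowitz1999, Lemma 2.5 (proof) p0005:L92-107] -/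
def linesBetween [Fintype L] [DecidableEq V] (W₁ W₂ : Finset V) : Finset L :=
  Finset.univ.filter fun l => (G.fst l ∈ W₁ ∧ G.snd l ∈ W₂) ∨ (G.fst l ∈ W₂ ∧ G.snd l ∈ W₁)

/-- One step of the graph-distance ball: add every vertex joined by a line to a vertex of `B`.
[cite: FeldmanSalmhoferTrubowitz1999, Lemma 2.5 (proof) p0005:L57-67] -/
def ballStep [Fintype V] [Fintype L] [DecidableEq V] (B : Finset V) : Finset V :=
  B ∪ Finset.univ.filter fun w => ∃ u ∈ B, ∃ l : L, G.Joins l u w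

/-- The closed ball of radius `n` about `v` in the graph distance (`n` steps of `ballStep` from
`{v}`): the vertices `w` with `s(w) ≤ n`, "`s(v)` the minimal number of steps required to walk from
`v₀` to `v` over lines of `G`"; `ball v₀ k` is the vertex set of `S_k`, `ball v_t m` that of `T_m`
(p0005:L57–77). [cite: FeldmanSalmhoferTrubowitz1999, Lemma 2.5 (proof) p0005:L57-77] -/
def ball [Fintype V] [Fintype L] [DecidableEq V] (v : V) (n : ℕ) : Finset V :=
  (G.ballStep)^[n] {v}

/-- The graph distance: the minimal number of steps required to walk from `v` to `w` over lines of
`G` (junk value `0` = `sInf ∅` when `w` cannot be reached; only used for connected graphs). For the two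
external vertices of a two-legged 1PI graph this is the integer `t` of §2.1 (p0005:L29–37: "The
integer `t` is the minimal number of steps required to walk from one to the other external vertex").
[cite: FeldmanSalmhoferTrubowitz1999, §2.1 p0005:L29-37] -/
noncomputable def edist [Fintype V] [Fintype L] [DecidableEq V] (v w : V) : ℕ :=
  sInf {n | w ∈ G.ball v n}

end Connectivity

section Subgraphs

variable (G : FGraph V L)

/-- `(W, M)` is a subgraph of `G`: a set `W` of vertices and a set `M` of internal lines of `G` with
both ends in `W`. [cite: FeldmanSalmhoferTrubowitz1999, §2 p0004:L31-32] -/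
def IsSubgraph (W : Finset V) (M : Finset L) : Prop := ∀ l ∈ M, G.fst l ∈ W ∧ G.snd l ∈ W

/-- The number of ends of the line `l` lying in the vertex set `W`.
[cite: FeldmanSalmhoferTrubowitz1999, §2 p0004:L19] -/
def endsIn [DecidableEq V] (W : Finset V) (l : L) : ℕ :=
  (if G.fst l ∈ W then 1 else 0) + (if G.snd l ∈ W then 1 else 0)

/-- The number of legs of the subgraph `(W, M)`: the external legs of `G` hooked to vertices of `W`,
plus the ends in `W` of the lines of `G` that are not lines of the subgraph (those lines are external
lines of the subgraph). [cite: FeldmanSalmhoferTrubowitz1999, §2 p0004:L19-32] -/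
def subgraphLegs [Fintype L] [DecidableEq V] [DecidableEq L] (W : Finset V) (M : Finset L) : ℕ :=
  (∑ v ∈ W, G.ext v) + ∑ l ∈ Finset.univ \ M, G.endsIn W l

/-- **Skeleton graph** (p0004:L31–32): "a connected graph with at least two vertices, that has no
two–legged vertices and no proper two–legged subgraphs" (proper: `(W, M) ≠ (V(G), L(G))`; see the
module docstring, Flag 3). [cite: FeldmanSalmhoferTrubowitz1999, §2 p0004:L31-32] -/
def IsSkeleton [Fintype V] [Fintype L] [DecidableEq V] [DecidableEq L] : Prop :=
  G.IsConnected ∧ 2 ≤ Fintype.card V ∧ (∀ v, G.incidence v ≠ 2) ∧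
    ∀ (W : Finset V) (M : Finset L), G.IsSubgraph W M → (W ≠ Finset.univ ∨ M ≠ Finset.univ) →
      G.subgraphLegs W M ≠ 2

/-- **One-particle irreducible (1PI)**: "`G` cannot be disconnected by cutting one internal line"
(p0004:L33–35; "If `G` is a two–legged skeleton graph, `G` is one-particle irreducible").
[cite: FeldmanSalmhoferTrubowitz1999, §2 p0004:L33-35] -/
def IsOnePI [Fintype L] [DecidableEq L] : Prop :=
  G.IsConnected ∧ ∀ l : L, ∀ v w, G.Reachable (Finset.univ.erase l) v w

end Subgraphs

section Loops

variable (G : FGraph V L)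

/-- `T ⊆ L(G)` is a spanning tree: "a subgraph of `G` that is a connected tree and contains all
vertices of `G`" (p0004:L44–45), in the form: the lines of `T` connect all vertices and
`|T| = |V(G)| - 1` (for a connecting set of lines this is equivalent to acyclicity; in particular a
spanning tree contains no self-contraction and no two parallel lines).
[cite: FeldmanSalmhoferTrubowitz1999, §2.1 p0004:L44-47] -/
def IsSpanningTree [Fintype V] (T : Finset L) : Prop :=
  (∀ v w, G.Reachable T v w) ∧ T.card + 1 = Fintype.card V

/-- "The loop generated by `ℓ` (and `T`) contains `θ`" (p0004:L48–53: for `ℓ ∉ L(T)` with ends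
`v ≠ w` "there is a unique path `P_ℓ` in `T` from `v` to `w`. The loop generated by `ℓ` … contains `ℓ`
and all lines of `P_ℓ`"; "If `v = w`, the loop generated by `ℓ` contains only the line `ℓ`"), in the
path-free form valid for a spanning tree `T` and `θ ∈ L(T)`: the tree path between the ends of `ℓ`
passes through `θ` iff the ends of `ℓ` are NOT connected in `T - θ`. For a self-contraction this is
false (`not_loopContains_of_isSelfContraction`), as printed. Junk outside `θ ∈ T`, `ℓ ∉ T`.
[cite: FeldmanSalmhoferTrubowitz1999, §2.1 p0004:L48-53] -/
def LoopContains [DecidableEq L] (T : Finset L) (l θ : L) : Prop :=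
  ¬ G.Reachable (T.erase θ) (G.fst l) (G.snd l)

/-- **Overlapping** (the notion of FST I, as recalled p0004:L54–58): "for some choice `T*` of the
spanning tree there are lines `θ ∈ L(T*)` and `ℓ₁ ≠ ℓ₂ ∈ L(G) ∖ L(T*)` such that the loops generated
by `ℓ_i` both contain `θ`". [cite: FeldmanSalmhoferTrubowitz1999, §2.1 p0004:L54-58] -/
def IsOverlapping [Fintype V] [DecidableEq L] : Prop :=
  ∃ T : Finset L, G.IsSpanningTree T ∧ ∃ θ ∈ T, ∃ l₁ ∉ T, ∃ l₂ ∉ T,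
    l₁ ≠ l₂ ∧ G.LoopContains T l₁ θ ∧ G.LoopContains T l₂ θ

/-- **Definition 2.1** (p0004:L73–78): the spanning tree `T` "gives rise to two separate overlaps if
there are lines `θ ≠ ζ ∈ T` and `ℓ₁, ℓ₂, k₁, k₂ ∈ L(G) ∖ L(T)`, all distinct, such that the loops
generated by `ℓ₁` and `ℓ₂` both contain `θ`, and the loops generated by `k₁` and `k₂` both contain
`ζ`, but not `θ`." [cite: FeldmanSalmhoferTrubowitz1999, Def 2.1 p0004:L73-78] -/
def TwoSeparateOverlaps [DecidableEq L] (T : Finset L) : Prop :=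
  ∃ θ ∈ T, ∃ ζ ∈ T, θ ≠ ζ ∧ ∃ l₁ l₂ k₁ k₂ : L,
    l₁ ∉ T ∧ l₂ ∉ T ∧ k₁ ∉ T ∧ k₂ ∉ T ∧
    l₁ ≠ l₂ ∧ l₁ ≠ k₁ ∧ l₁ ≠ k₂ ∧ l₂ ≠ k₁ ∧ l₂ ≠ k₂ ∧ k₁ ≠ k₂ ∧
    G.LoopContains T l₁ θ ∧ G.LoopContains T l₂ θ ∧
    G.LoopContains T k₁ ζ ∧ G.LoopContains T k₂ ζ ∧
    ¬ G.LoopContains T k₁ θ ∧ ¬ G.LoopContains T k₂ θ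

/-- **Doubly overlapping (DOL)** (Definition 2.1, p0004:L79–80): "We call a graph doubly overlapping
(DOL) if it has a spanning tree `T*` that gives rise to two separate overlaps."
[cite: FeldmanSalmhoferTrubowitz1999, Def 2.1 p0004:L79-80] -/
def IsDOL [Fintype V] [DecidableEq L] : Prop :=
  ∃ T : Finset L, G.IsSpanningTree T ∧ G.TwoSeparateOverlaps T

end Loops

section Shapes

variable (G : FGraph V L) [Fintype V] [Fintype L] [DecidableEq V]

/-- `G` is, modulo self-contractions, **the sunset** with external vertices `a`, `b` (Figure 1): its
only vertices are `a ≠ b`, joined by exactly three lines. (External legs are fixed by the hypotheses of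
the theorems: one at `a`, one at `b`.) [cite: FeldmanSalmhoferTrubowitz1999, §2.2 (Figure 1) p0006:L44-46] -/
def IsSunsetShape (a b : V) : Prop :=
  a ≠ b ∧ Finset.univ = ({a, b} : Finset V) ∧ G.lineCount a b = 3

/-- `G` is, modulo self-contractions, **the multiple sunset** (Figure 7, "`m ≥ 5`"): its only vertices
are `a ≠ b`, joined by `m ≥ 5` lines ("because there are five or more lines connecting the two
vertices", §3.5; `m` is odd by even incidence). [cite: FeldmanSalmhoferTrubowitz1999, §2.2 (Figure 7) p0006:L44-46] -/
def IsMultipleSunsetShape (a b : V) : Prop :=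
  a ≠ b ∧ Finset.univ = ({a, b} : Finset V) ∧ 5 ≤ G.lineCount a b

/-- `G` is, modulo self-contractions, **the wicked ladder with `n` bubbles** between the external
vertices `a` and `b` (Figure 12: "There may be an arbitrary number of bubbles"): the vertices are
exactly `a = u₀, u₁, …, uₙ = b` (distinct), consecutive ones `u_i, u_{i+1}` are joined by exactly two
lines (a bubble), `a` and `b` are joined by one further line, and no other line joins two distinct
vertices. Used with `n ≥ 2`; for `n = 1` the description degenerates to the sunset (three lines
`a—b`). [cite: FeldmanSalmhoferTrubowitz1999, §2.2 (Figure 12) p0006:L95-103] -/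
def IsWickedLadderShape (a b : V) (n : ℕ) : Prop :=
  ∃ u : Fin (n + 1) → V, Function.Bijective u ∧ u 0 = a ∧ u (Fin.last n) = b ∧
    ∀ i j : Fin (n + 1), i < j →
      G.lineCount (u i) (u j) =
        (if (j : ℕ) = i + 1 then 2 else 0) + (if i = 0 ∧ j = Fin.last n then 1 else 0)

end Shapes

end FGraph

/-! ### The named facts: Lemma 2.5 (with Theorem 2.4) and Theorem 2.6 -/

/-- **Lemma 2.5** (FST III p0005:L43–47; PDF "**Lemma 2.5**"), NAMED FACT (licence F-035): "Let `G` be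
a two–legged skeleton graph and `t ≥ 2`. Then `G` is DOL. More precisely, for all `r, s` with
`0 ≤ r < s ≤ t-1`, `G` takes the form shown in Figure 3. The subgraphs `G₁` and `G₂` are connected,
and each of them connects to `G'` by at least three lines." Here `a`, `b` are the two external vertices
(one external leg each), `t = edist a b`; Figure 3 is typed with the sets of the printed proof
(p0005:L81–107): `G₁ = S_r = ball a r`, `G₂ = T_{t-s-1} = ball b (t-s-1)`, `G'` the remaining vertices;
typed conclusions: `G₁ ∩ G₂ = ∅`, `G₁` and `G₂` connected, no line joins `G₁` to `G₂` ("by minimality of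
`θ`", L95–99), at least three lines join `G₁` to `G'` and at least three join `G₂` to `G'` ("`k₁ ≥ 3`
and `k₂ ≥ 3`", L106). The printed refinement "If it is not possible to choose `G₁`, `G₂` and `G'` all
connected, then `G` is as indicated in Figure 5, with `C'` and `C₁` connected and `m̄₁ ≥ 2` … and
`n₁ ≥ 3`, or as in Figure 6, with `C₁` connected, and with `m̄ ≥ 2` and `n̄ ≥ 2`" (p0005:L48–55) is not
typed (module docstring, Flag 2). The standing even-incidence assumption (p0004:L26) is an explicit
hypothesis. `ℕ`-subtraction `t - s - 1` is guarded by `s + 1 ≤ t`.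
[cite: FeldmanSalmhoferTrubowitz1999, Lemma 2.5 p0005:L43-47] -/
def lemma25 : Prop :=
  ∀ (V L : Type) [Fintype V] [DecidableEq V] [Fintype L] [DecidableEq L] (G : FGraph V L) (a b : V),
    G.EvenIncidence → G.IsTwoLegged → G.ext a = 1 → G.ext b = 1 → G.IsSkeleton →
      2 ≤ G.edist a b →
        G.IsDOL ∧
        ∀ r s : ℕ, r < s → s + 1 ≤ G.edist a b →
          Disjoint (G.ball a r) (G.ball b (G.edist a b - s - 1)) ∧
          G.IsConnectedOn (G.ball a r) ∧
          G.IsConnectedOn (G.ball b (G.edist a b - s - 1)) ∧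
          G.linesBetween (G.ball a r) (G.ball b (G.edist a b - s - 1)) = ∅ ∧
          3 ≤ (G.linesBetween (G.ball a r) (G.ball a r ∪ G.ball b (G.edist a b - s - 1))ᶜ).card ∧
          3 ≤ (G.linesBetween (G.ball b (G.edist a b - s - 1))
                (G.ball a r ∪ G.ball b (G.edist a b - s - 1))ᶜ).card

/-- **Theorem 2.4** (FST III p0005:L39–41; PDF "**Theorem 2.4**"): "All two–legged skeleton graphs with
`t ≥ 2` are doubly overlapping. This theorem is a direct consequence of the following, more detailed,
lemma" — PROVED from the named fact `lemma25` (its first conclusion).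
[cite: FeldmanSalmhoferTrubowitz1999, Thm 2.4 p0005:L39-41] -/
theorem theorem24 (h : lemma25) {V L : Type} [Fintype V] [DecidableEq V] [Fintype L] [DecidableEq L]
    (G : FGraph V L) (a b : V) (hev : G.EvenIncidence) (h2 : G.IsTwoLegged) (ha : G.ext a = 1)
    (hb : G.ext b = 1) (hsk : G.IsSkeleton) (ht : 2 ≤ G.edist a b) : G.IsDOL :=
  (h V L G a b hev h2 ha hb hsk ht).1

/-- **Theorem 2.6** (FST III p0006:L106–108; PDF "**Theorem 2.6**"), NAMED FACT (licence F-036): "Let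
`G` be a non–DOL two–legged skeleton graph. Then `G` is a sunset, or a multiple sunset, or a wicked
ladder, with the vertices possibly being `2m`–legged vertices with `m-2` self–contractions." TYPED FOR
THE PRINTED SET-UP OF §2.1–§2.2: the two external legs sit at two distinct vertices `a ≠ b` ("We call the
external vertices `v₀` and `v₁`", p0006:L44) — see the module docstring, Flag 1: with both legs at one
vertex (`t = 0`, the case Theorem 3.11 lists separately as "has only one external vertex") the literal
statement fails, e.g. for that vertex joined by four lines to a four-legged vertex. "Modulo
self-contractions" is built into the shape predicates (they only count lines between distinct
vertices). The standing even-incidence assumption (p0004:L26) is an explicit hypothesis.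
[cite: FeldmanSalmhoferTrubowitz1999, Thm 2.6 p0006:L106-108] -/
def theorem26 : Prop :=
  ∀ (V L : Type) [Fintype V] [DecidableEq V] [Fintype L] [DecidableEq L] (G : FGraph V L) (a b : V),
    G.EvenIncidence → G.IsTwoLegged → G.ext a = 1 → G.ext b = 1 → a ≠ b → G.IsSkeleton →
      ¬ G.IsDOL →
        G.IsSunsetShape a b ∨ G.IsMultipleSunsetShape a b ∨ ∃ n : ℕ, 2 ≤ n ∧ G.IsWickedLadderShape a b n

/-! ### Sanity theorems (proved; elementary consequences of the definitions, as remarked in print) -/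

namespace FGraph

variable {V : Type u} {L : Type v}

/-- "If `v = w`, the loop generated by `ℓ` contains only the line `ℓ`" (p0004:L50): a
self-contraction's loop contains no tree line. [cite: FeldmanSalmhoferTrubowitz1999, §2.1 p0004:L50] -/
theorem not_loopContains_of_isSelfContraction [DecidableEq L] (G : FGraph V L) {l : L}
    (hl : G.IsSelfContraction l) (T : Finset L) (θ : L) : ¬ G.LoopContains T l θ := by
  intro h
  apply h
  rw [IsSelfContraction] at hl
  rw [hl]
  exact Relation.ReflTransGen.refl

/-- A DOL graph is overlapping (the lines `θ`, `ℓ₁`, `ℓ₂` of Definition 2.1 witness it).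
[cite: FeldmanSalmhoferTrubowitz1999, Def 2.1 p0004:L73-80] -/
theorem IsDOL.isOverlapping [Fintype V] [DecidableEq L] {G : FGraph V L} (h : G.IsDOL) :
    G.IsOverlapping := by
  obtain ⟨T, hT, θ, hθ, _ζ, _hζ, _hne, l₁, l₂, _k₁, _k₂, hl₁, hl₂, _, _, h12, _, _, _, _, _,
    hL₁, hL₂, _⟩ := h
  exact ⟨T, hT, θ, hθ, l₁, hl₁, l₂, hl₂, h12, hL₁, hL₂⟩

/-- A DOL graph "has to have at least three vertices, because otherwise there can be at most one line
in the spanning tree" (p0004:L84–85). [cite: FeldmanSalmhoferTrubowitz1999, §2.1 p0004:L82-85] -/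
theorem IsDOL.three_le_card [Fintype V] [DecidableEq L] {G : FGraph V L} (h : G.IsDOL) :
    3 ≤ Fintype.card V := by
  obtain ⟨T, ⟨_, hcard⟩, θ, hθ, ζ, hζ, hne, _⟩ := h
  have h2 : 2 ≤ T.card := by
    have hsub : ({θ, ζ} : Finset L) ⊆ T := by
      intro x hx
      simp only [Finset.mem_insert, Finset.mem_singleton] at hx
      rcases hx with rfl | rfl
      · exact hθ
      · exact hζ
    calc 2 = ({θ, ζ} : Finset L).card := (Finset.card_pair hne).symm
      _ ≤ T.card := Finset.card_le_card hsub
  omega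

/-- Graphs with at most two vertices are not DOL. [cite: FeldmanSalmhoferTrubowitz1999, §2.1 p0004:L82-85] -/
theorem not_isDOL_of_card_le_two [Fintype V] [DecidableEq L] (G : FGraph V L)
    (h : Fintype.card V ≤ 2) : ¬ G.IsDOL :=
  fun hd => absurd hd.three_le_card (by omega)

/-- "the sunset graph of Figure 1 is not DOL" (p0004:L82–83): it has two vertices.
[cite: FeldmanSalmhoferTrubowitz1999, §2.1 p0004:L82-83] -/
theorem IsSunsetShape.not_isDOL [Fintype V] [Fintype L] [DecidableEq V] [DecidableEq L]
    {G : FGraph V L} {a b : V} (h : G.IsSunsetShape a b) : ¬ G.IsDOL := by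
  refine G.not_isDOL_of_card_le_two ?_
  rw [← Finset.card_univ, h.2.1]
  exact Finset.card_le_two

/-- The multiple sunset (Figure 7) is not DOL: it has two vertices.
[cite: FeldmanSalmhoferTrubowitz1999, §2.1 p0004:L82-85] -/
theorem IsMultipleSunsetShape.not_isDOL [Fintype V] [Fintype L] [DecidableEq V] [DecidableEq L]
    {G : FGraph V L} {a b : V} (h : G.IsMultipleSunsetShape a b) : ¬ G.IsDOL := by
  refine G.not_isDOL_of_card_le_two ?_
  rw [← Finset.card_univ, h.2.1]
  exact Finset.card_le_two

/-- `v` lies in every ball about itself. [cite: FeldmanSalmhoferTrubowitz1999, Lemma 2.5 (proof) p0005:L59] -/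
theorem mem_ball_self [Fintype V] [Fintype L] [DecidableEq V] (G : FGraph V L) (v : V) (n : ℕ) :
    v ∈ G.ball v n := by
  induction n with
  | zero => simp [ball]
  | succ n ih =>
    rw [ball, Function.iterate_succ_apply']
    exact Finset.mem_union_left _ ih

/-- The balls increase with the radius. [cite: FeldmanSalmhoferTrubowitz1999, Lemma 2.5 (proof) p0005:L63-65] -/
theorem ball_subset_ball_succ [Fintype V] [Fintype L] [DecidableEq V] (G : FGraph V L) (v : V)
    (n : ℕ) : G.ball v n ⊆ G.ball v (n + 1) := by
  rw [ball, ball, Function.iterate_succ_apply']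
  exact Finset.subset_union_left

/-- "`s(v₀) = 0`": the distance from a vertex to itself is `0`.
[cite: FeldmanSalmhoferTrubowitz1999, Lemma 2.5 (proof) p0005:L59] -/
theorem edist_self [Fintype V] [Fintype L] [DecidableEq V] (G : FGraph V L) (v : V) :
    G.edist v v = 0 := by
  apply Nat.eq_zero_of_le_zero
  exact Nat.sInf_le (G.mem_ball_self v 0)

/-- Two vertices at distance `≥ 1` are distinct (so in `lemma25` the external vertices `a`, `b` with
`t ≥ 2` are automatically distinct). [cite: FeldmanSalmhoferTrubowitz1999, §2.1 p0005:L29-37] -/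
theorem ne_of_edist_pos [Fintype V] [Fintype L] [DecidableEq V] (G : FGraph V L) {v w : V}
    (h : 0 < G.edist v w) : v ≠ w := by
  rintro rfl
  rw [edist_self] at h
  exact lt_irrefl 0 h

end FGraph

end FST3

end Literature.MathematicalPhysics.QuantumLattice.FermiRG
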